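import Summits.QuantumFields.BalabanUV.Beta.EriceRemainderEnclosureHistoryAutonomyComparisonGapPersistence
import Summits.QuantumFields.BalabanUV.Beta.EriceRemainderEnclosureHistoryAutonomyComparisonTowerUniform

/-!
# EriceRemainderEnclosureHistoryAutonomyComparisonSlackCriterion — (E64e) THE SLACK CRITERION: `B(u) = b + Σ_{k<K} L_k·u_k` (ANY finite set of ages
# `A ⊆ [1,K[`, sizes and Markov weight ARBITRARY) compares at any size under every isotone excess as soon as its SLACK SYSTEM — loads `x̂_j = L_j∕(2P_j)`,
# couplings `(k′∕(k′+j))²` — has a CERTIFICATE `π ≥ 0`: `π_{k′} + Σ_j x̂_j(k′∕(k′+j))²π_j ≥ 1` (`k′ ∈ A`), `Σ_j x̂_jπ_j ≤ 1`.  Trajectory-free, checkable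
# profile by profile (a finite linear feasibility problem); the framework behind (E64c) for arbitrary — dense or sparse — age sets

Cell `pub-balaban`, β-function sub-cell, BINDER row D4 «RemainderConst leaves for Bałaban's split» (`HOME/BINDER-OWNERS.md`; owner lineage `b2b-balaban-beta-an4`;
this file by co-owner #2 lineage `b2b-balaban-beta-d4-p2`, generation 57), β-FLOW TEAM duty (1), FREEZE (0) honoured (def-free; (E64a)'s `gap_persist`, (E63a)'s
`le_of_isotone_excess_of_step_below`, (E58b)'s `weight_le_profile`, (E49j)'s `excess_shift_le`, (E48a)'s `strictAnti_of_memFlow` ∕ `le_of_pin_le` ∕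
`memFlow_tail`, node U2's `invSq_eq_of_memFlow` ∕ `drive` ∕ `mul_lower_le_drive` ∕ `Sharpness.abs_sub_le_half_cube_mul`, (E43)'s `affine_monotone` ∕
`affine_floor` ∕ `affine_zerothMoment` BY NAME; nothing restated).  Companion of (E64c) `…ComparisonTowerSlack` (towers, certificate from (E64b)).

HONEST FRAMING (page 1, verbatim and binding).  *"Discharging BetaPertH makes Bałaban's UV stability UNCONDITIONAL — a real constructive-QFT result; it is
NOT the continuum limit and NOT the Clay problem."*  THIS FILE DISCHARGES NOTHING OF THE KIND.  Elementary real analysis about ABSTRACT affine functionals on a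
box ]0,γ]^ℕ with displayed supports and signs — hypotheses of a census, not facts; the form, signs, ages and moments of Bałaban's (1.22) limit functional are
NOT PRINTED ([I] p. 298; GAPS G-t4-U2-1∕-2) and NOT asserted.  Row D4 class UNCHANGED (critical-path width 0; instance 0∕1; D4 DISCHARGE NO DATE).  HONEST
DEPENDENCY: continuum YM on T⁴ ⇐ BetaPertH ∧ nine spine estimates (0/9 proved); BetaPertH ⇐ (D1) ∧ (D4) ∧ CAP+tail; G-an2-4 gates asym, D1 and NE2/3/4.

THE POINT (census sense (α); the COMPARISON column, conjecture (E58′)).  (E58b)'s PROFILE CONDITION `Σ_j L_j∕P_j ≤ 2` is the first-order barrier: every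
pin read `ρ_j = L_j(h_j − h′_j)` is bounded by `x̂_j·η` separately and the loads must sum below `1`.  THE SLACK SYSTEM keeps the coupling: along the
comparison configuration `ρ_j ≤ x̂_j·(η − Σ_{k′∈A}(k′∕(k′+j))²·ρ_{k′})` for EVERY age `j ∈ A` (§2: `δ_j ≤ j·η − Σ_{l≤j} dd_l`, `δ_j ≥ 0`, and (E64a)'s gap
persistence `dd_l ≥ Σ_{k′}(k′∕(k′+l))²ρ_{k′}`), and by weak duality (§1) ANY `π ≥ 0` with `π_{k′} + Σ_j x̂_j(k′∕(k′+j))²π_j ≥ 1`, `Σ_j x̂_jπ_j ≤ 1` certifies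
`Σ_j ρ_j ≤ η` — THE STEP; (E63a)'s principle does the rest (§3 `le_of_isotone_excess_slack_certificate`).  Examples: ONE age (`x̂ = √2∕2`, `π = 1∕(1+√2∕8)`,
cost `0.60`); towers of any height at ratio `≥ 30` ((E64b) is a certificate in disguise); numerically (`HOME/…/g57/e64/README.md`, `bilevel.py`) the system
with the profile-free JOINT BUDGETS `Σ_{k≤j} x_k√(k∕j) + Σ_{k>j} x_k(j∕k) ≤ √2∕2` (one per scale `j`, from `j·Σ_k L_k h_{j+k} ≤ 1∕h_j²`) has value `< 1` on every
age set searched (dense `1..8`: `≤ 0.77`; towers: `≤ 0.93` at height 4, ratio 30) — i.e. NO counterexample to «the slack system always certifies», which would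
settle (E58′) for every profile; that finite-dimensional inequality is OPEN.  NOT CLAIMED: that every profile has a certificate; anything printed.

WHAT IS PROVED ([folklore]; 0 `def`, 0 sorry).  §1 **`sum_le_of_certificate`** (weak duality).  §2 **`effective_le_of_family_le_at_certificate`** (THE STEP).  §3
**`le_of_isotone_excess_slack_certificate`** (END, trajectory-free).
-/
noncomputable section
open Finset Set

namespace Summit.QuantumFields.BalabanUV.Beta.EriceRemainderEnclosureHistoryAutonomyComparisonSlackCriterion

open Literature.MathematicalPhysics.QuantumFieldTheory.Balaban1983to89
open Literature.MathematicalPhysics.QuantumFieldTheory.Balaban1983to89.T4BetaStationary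
open Literature.MathematicalPhysics.QuantumFieldTheory.Balaban1983to89.T4BetaFlowWellPosed
open Literature.MathematicalPhysics.QuantumFieldTheory.Balaban1983to89.T4BetaFlowWellPosed.Sharpness (abs_sub_le_half_cube_mul)
open Summit.QuantumFields.BalabanUV.Beta.EriceRemainderEnclosureHistoryAutonomyOrder (strictAnti_of_memFlow le_of_pin_le memFlow_tail)
open Summit.QuantumFields.BalabanUV.Beta.EriceRemainderEnclosureHistoryAutonomyComparisonExcess (excess_shift_le)
open Summit.QuantumFields.BalabanUV.Beta.EriceRemainderEnclosureHistoryAutonomyComparisonAffineProfile (weight_le_profile)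
open Summit.QuantumFields.BalabanUV.Beta.EriceRemainderEnclosureHistoryAutonomyComparisonTowerUniform (ratio_le_sqrt_two)
open Summit.QuantumFields.BalabanUV.Beta.EriceRemainderEnclosureHistoryAutonomyComparisonDropBound (le_of_isotone_excess_of_step_below)
open Summit.QuantumFields.BalabanUV.Beta.EriceRemainderEnclosureHistoryAutonomyComparisonGapPersistence (gap_persist)
open Summit.QuantumFields.BalabanUV.Beta.EriceRemainderEnclosureHistoryAutonomyMonotone (affine_monotone affine_floor affine_zerothMoment)

variable {B' : (ℕ → ℝ) → ℝ} {M' γ b y : ℝ} {L xh π : ℕ → ℝ} {K : ℕ} {A : Finset ℕ} {h h' : ℕ → ℝ} {S S' : ℝ → ℕ → ℝ}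

/-! ## §1 Weak duality for the slack system -/

/-- **WEAK DUALITY FOR THE SLACK SYSTEM.**  Reals `ρ_k ≥ 0`, `x̂_k ≥ 0` (`k ∈ A`), `η`, couplings `G k′ j`, and THE SYSTEM
`ρ_j ≤ x̂_j·(η − Σ_{k′∈A} G k′ j·ρ_{k′})` for `j ∈ A`; a CERTIFICATE `π ≥ 0` on `A` with `π_{k′} + Σ_{j∈A} x̂_j·G k′ j·π_j ≥ 1` for every `k′ ∈ A` and
`Σ_{j∈A} x̂_j·π_j ≤ 1`.  Then `Σ_{k∈A} ρ_k ≤ η` (multiply row `j` by `π_j`, sum, exchange). [folklore] -/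
theorem sum_le_of_certificate {ρ : ℕ → ℝ} {G : ℕ → ℕ → ℝ} {η : ℝ} (hρ : ∀ k ∈ A, 0 ≤ ρ k) (hπ : ∀ k ∈ A, 0 ≤ π k)
    (hsys : ∀ j ∈ A, ρ j ≤ xh j * (η - ∑ k' ∈ A, G k' j * ρ k'))
    (hdual : ∀ k' ∈ A, 1 ≤ π k' + ∑ j ∈ A, xh j * G k' j * π j) (hcost : ∑ j ∈ A, xh j * π j ≤ 1) (hη : 0 ≤ η) :
    ∑ k ∈ A, ρ k ≤ η := by
  -- Σ_j π_j (ρ_j + x̂_j Σ_{k'} G ρ) ≤ η Σ_j x̂_j π_j ≤ η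
  have hrow : ∀ j ∈ A, π j * ρ j + π j * xh j * ∑ k' ∈ A, G k' j * ρ k' ≤ η * (xh j * π j) := by
    intro j hj
    have := mul_le_mul_of_nonneg_left (hsys j hj) (hπ j hj)
    nlinarith
  have hsum := sum_le_sum hrow
  rw [← mul_sum] at hsum
  -- exchange the double sum
  have hex : ∑ j ∈ A, (π j * ρ j + π j * xh j * ∑ k' ∈ A, G k' j * ρ k') = ∑ k' ∈ A, ρ k' * (π k' + ∑ j ∈ A, xh j * G k' j * π j) := by
    have e1 : ∑ j ∈ A, π j * xh j * ∑ k' ∈ A, G k' j * ρ k' = ∑ k' ∈ A, ρ k' * ∑ j ∈ A, xh j * G k' j * π j := by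
      simp_rw [mul_sum]
      rw [sum_comm]
      exact sum_congr rfl fun k' _ => sum_congr rfl fun j _ => by ring
    rw [sum_add_distrib, e1, ← sum_add_distrib]
    exact sum_congr rfl fun k' _ => by ring
  rw [hex] at hsum
  calc ∑ k ∈ A, ρ k ≤ ∑ k' ∈ A, ρ k' * (π k' + ∑ j ∈ A, xh j * G k' j * π j) :=
        sum_le_sum fun k' hk' => by
          have := mul_le_mul_of_nonneg_left (hdual k' hk') (hρ k' hk')
          linarith
    _ ≤ η * ∑ j ∈ A, xh j * π j := hsum
    _ ≤ η * 1 := mul_le_mul_of_nonneg_left hcost hη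
    _ = η := mul_one η

/-! ## §2 THE STEP under a slack certificate -/

/-- **THE STEP UNDER A SLACK CERTIFICATE.**  `B(u) = b + Σ_{k<K} L_k·u_k` (`b > 0`, `L ≥ 0` supported on `{0} ∪ A`, `A ⊆ [1,K[` ANY finite set of ages, sizes
AND Markov weight ARBITRARY); `B ≤ B′` with ISOTONE excess; solution families `S`, `S′`; a pin `y` at which comparison from every deeper pin `z` is handed;
box solutions `h′ ≤ h` of `B`, `B′` from `y`; load bounds `x̂_j ≥ j·L_j·h_j³∕2` along `h` (`j ∈ A`); and a CERTIFICATE `π ≥ 0` on `A` for the couplings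
`G k′ j = (k′∕(k′+j))²`: `π_{k′} + Σ_{j∈A} x̂_j(k′∕(k′+j))²π_j ≥ 1` (`k′ ∈ A`), `Σ_{j∈A} x̂_jπ_j ≤ 1`.  Then `B h ≤ B′ h′`.  THE CHAIN: `ρ_j = L_j(h_j − h′_j) ≤
(L_jh_j³∕2)·δ_j`, `δ_j ≤ j·η − Σ_{l=1}^{j} dd_l` and `δ_j ≥ 0`, `dd_l ≥ Σ_{k′∈A} (k′∕(k′+l))²ρ_{k′}` ((E64a) `gap_persist` with `U = S(h′_{k′})`) — so
`ρ_j ≤ x̂_j(η − Σ_{k′}(k′∕(k′+j))²ρ_{k′})` — and §1. [folklore] -/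
theorem effective_le_of_family_le_at_certificate (hL : ∀ k, 0 ≤ L k) (hb : 0 < b) (hAK : A ⊆ range K) (hA1 : ∀ k ∈ A, 1 ≤ k)
    (hsupp : ∀ k ∈ range K, k ∉ A → k ≠ 0 → L k = 0)
    (hexc : ∀ u, SeqBox γ u → (fun u : ℕ → ℝ => b + ∑ k ∈ range K, L k * u k) u ≤ B' u)
    (hDmono : ∀ u v : ℕ → ℝ, SeqBox γ u → SeqBox γ v → (∀ j, u j ≤ v j) →
      B' u - (fun u : ℕ → ℝ => b + ∑ k ∈ range K, L k * u k) u ≤ B' v - (fun u : ℕ → ℝ => b + ∑ k ∈ range K, L k * u k) v)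
    (hS : ∀ p, 0 < p → p ≤ γ → SeqBox γ (S p) ∧ MemFlow (fun u : ℕ → ℝ => b + ∑ k ∈ range K, L k * u k) p (S p))
    (huniq : ∀ p, 0 < p → p ≤ γ → ∀ u u' : ℕ → ℝ, SeqBox γ u → SeqBox γ u' →
      MemFlow (fun u : ℕ → ℝ => b + ∑ k ∈ range K, L k * u k) p u → MemFlow (fun u : ℕ → ℝ => b + ∑ k ∈ range K, L k * u k) p u' → u = u')
    (hS' : ∀ p, 0 < p → p ≤ γ → SeqBox γ (S' p) ∧ MemFlow B' p (S' p))
    (huniq' : ∀ p, 0 < p → p ≤ γ → ∀ u u' : ℕ → ℝ, SeqBox γ u → SeqBox γ u' → MemFlow B' p u → MemFlow B' p u' → u = u')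
    (hy : 0 < y)
    (hdeep : ∀ z, 0 < z → z ≤ γ → 1 / y ^ 2 + b ≤ 1 / z ^ 2 →
      (fun u : ℕ → ℝ => b + ∑ k ∈ range K, L k * u k) (S z) ≤ B' (S' z) ∧ ∀ j, S' z j ≤ S z j)
    (hh : SeqBox γ h) (hf : MemFlow (fun u : ℕ → ℝ => b + ∑ k ∈ range K, L k * u k) y h) (hh' : SeqBox γ h') (hf' : MemFlow B' y h')
    (hle : ∀ j, h' j ≤ h j)
    (hxh : ∀ j ∈ A, L j * j * h j ^ 3 ≤ 2 * xh j) (hπ : ∀ k ∈ A, 0 ≤ π k)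
    (hdual : ∀ k' ∈ A, 1 ≤ π k' + ∑ j ∈ A, xh j * ((k' : ℝ) / ((k' : ℝ) + j)) ^ 2 * π j) (hcost : ∑ j ∈ A, xh j * π j ≤ 1) :
    (fun u : ℕ → ℝ => b + ∑ k ∈ range K, L k * u k) h ≤ B' h' := by
  set B : (ℕ → ℝ) → ℝ := fun u => b + ∑ k ∈ range K, L k * u k with hB_def
  have hmono : ∀ u v : ℕ → ℝ, SeqBox γ u → SeqBox γ v → (∀ j, u j ≤ v j) → B u ≤ B v := affine_monotone hL
  have hlo : ∀ u, SeqBox γ u → b ≤ B u := affine_floor hL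
  have hBzm := affine_zerothMoment (γ := γ) (b₀ := b) (K := K) hL
  have hM : 0 ≤ ∑ k ∈ range K, L k := sum_nonneg fun k _ => hL k
  have hlo' : ∀ u, SeqBox γ u → b ≤ B' u := fun u hu => (hlo u hu).trans (hexc u hu)
  have hanti' : Antitone h' := (strictAnti_of_memFlow hb hlo' hh' hf').antitone
  set η : ℝ := B' h' - B h' with hη_def
  have hη0 : 0 ≤ η := by rw [hη_def]; linarith [hexc h' hh']
  have hg0 : ∀ j, 0 ≤ h j - h' j := fun j => sub_nonneg.mpr (hle j)
  have hdd : ∀ m, B (fun j => h (m + j)) - B (fun j => h' (m + j)) = ∑ k ∈ range K, L k * (h (m + k) - h' (m + k)) := by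
    intro m; simp only [hB_def]; rw [add_sub_add_left_eq_sub, ← sum_sub_distrib]; exact sum_congr rfl fun k _ => by ring
  -- (1) level gaps: 0 ≤ δ_j ≤ j·η − (drops read at scales 1..j)
  have hlev : ∀ j : ℕ, 1 / h' j ^ 2 - 1 / h j ^ 2 ≤
      (j : ℝ) * η - ∑ l ∈ range j, ∑ k ∈ range K, L k * (h (l + 1 + k) - h' (l + 1 + k)) := by
    intro j
    rw [invSq_eq_of_memFlow hf j, invSq_eq_of_memFlow hf' j,
      show (1:ℝ) / y ^ 2 + drive B' h' j - (1 / y ^ 2 + drive B h j) = drive B' h' j - drive B h j by ring]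
    unfold drive
    rw [← sum_sub_distrib]
    have hterm : ∀ l ∈ range j, B' (fun i => h' (l + 1 + i)) - B (fun i => h (l + 1 + i)) ≤
        η - ∑ k ∈ range K, L k * (h (l + 1 + k) - h' (l + 1 + k)) := by
      intro l _
      have e1 := (abs_le.mp (excess_shift_le hexc hDmono hh' hanti' l)).1
      have e2 := hdd (l + 1)
      simp only [hB_def] at e1 e2 ⊢
      linarith
    calc ∑ l ∈ range j, (B' (fun i => h' (l + 1 + i)) - B (fun i => h (l + 1 + i)))
        ≤ ∑ l ∈ range j, (η - ∑ k ∈ range K, L k * (h (l + 1 + k) - h' (l + 1 + k))) := sum_le_sum hterm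
      _ = (j : ℝ) * η - ∑ l ∈ range j, ∑ k ∈ range K, L k * (h (l + 1 + k) - h' (l + 1 + k)) := by
          rw [sum_sub_distrib, sum_const, card_range, nsmul_eq_mul]
  have hlev0 : ∀ j : ℕ, 0 ≤ 1 / h' j ^ 2 - 1 / h j ^ 2 := fun j =>
    sub_nonneg.mpr (one_div_le_one_div_of_le (pow_pos (hh' j).1 2) (pow_le_pow_left₀ (hh' j).1.le (hle j) 2))
  -- (2) GAP PERSISTENCE at every age of A, through U = S (h′ k′)
  have hpers : ∀ k' ∈ A, ∀ l : ℕ, ((k' : ℝ) / ((k' : ℝ) + l)) ^ 2 * (h k' - h' k') ≤ h (k' + l) - h' (k' + l) := by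
    intro k' hk'A l
    have hk'1 : 1 ≤ k' := hA1 k' hk'A
    have hz := (hh' k').1
    have hzγ := (hh' k').2
    have hzdeep : 1 / y ^ 2 + b ≤ 1 / h' k' ^ 2 := by
      rw [invSq_eq_of_memFlow hf' k']
      have := mul_lower_le_drive hlo' hh' k'
      have hk'r : (1 : ℝ) ≤ k' := by exact_mod_cast hk'1
      nlinarith
    obtain ⟨hU, hfU⟩ := hS (h' k') hz hzγ
    have hUle : ∀ i, S (h' k') i ≤ h (k' + i) := fun i =>
      le_of_pin_le (B := B) hb hBzm hM hlo huniq hz (hle k') (hh k').2 hU (seqBox_shift hh k') hfU (memFlow_tail hf k') i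
    have htail : (fun j => h' (k' + j)) = S' (h' k') :=
      huniq' (h' k') hz hzγ _ _ (seqBox_shift hh' k') (hS' _ hz hzγ).1 (memFlow_tail hf' k') (hS' _ hz hzγ).2
    have hleU : ∀ i, h' (k' + i) ≤ S (h' k') i := fun i => by
      have := (hdeep (h' k') hz hzγ hzdeep).2 i
      rwa [← htail] at this
    exact gap_persist hL hb hy hh hf hh' hle hk'1 hU hfU hUle hleU l
  -- pin reads and couplings
  set ρ : ℕ → ℝ := fun k => L k * (h k - h' k) with hρ_def
  set G : ℕ → ℕ → ℝ := fun k' j => ((k' : ℝ) / ((k' : ℝ) + j)) ^ 2 with hG_def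
  have hρ0 : ∀ k, 0 ≤ ρ k := fun k => mul_nonneg (hL _) (hg0 _)
  have hG0 : ∀ k' j, 0 ≤ G k' j := fun k' j => by positivity
  -- (3) the drop read at scale l+1 re-reads every pin read, damped
  have hddlow : ∀ l : ℕ, ∑ k' ∈ A, G k' (l + 1) * ρ k' ≤ ∑ k ∈ range K, L k * (h (l + 1 + k) - h' (l + 1 + k)) := by
    intro l
    calc ∑ k' ∈ A, G k' (l + 1) * ρ k'
        ≤ ∑ k' ∈ A, L k' * (h (l + 1 + k') - h' (l + 1 + k')) := sum_le_sum fun k' hk' => by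
          have hp := hpers k' hk' (l + 1)
          rw [show k' + (l + 1) = l + 1 + k' by omega] at hp
          push_cast at hp
          calc G k' (l + 1) * ρ k' = L k' * (((k' : ℝ) / ((k' : ℝ) + (l + 1))) ^ 2 * (h k' - h' k')) := by
                simp only [hρ_def, hG_def]; push_cast; ring
            _ ≤ L k' * (h (l + 1 + k') - h' (l + 1 + k')) := mul_le_mul_of_nonneg_left hp (hL _)
      _ ≤ ∑ k ∈ range K, L k * (h (l + 1 + k) - h' (l + 1 + k)) :=
          sum_le_sum_of_subset_of_nonneg hAK fun k _ _ => mul_nonneg (hL k) (hg0 _)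
  -- (4) the system: ρ_j ≤ x̂_j (η − Σ_{k'∈A} G k' j ρ_{k'})
  have hsys : ∀ j ∈ A, ρ j ≤ xh j * (η - ∑ k' ∈ A, G k' j * ρ k') := by
    intro j hjA
    have hj1 : 1 ≤ j := hA1 j hjA
    have hjr : (0 : ℝ) < j := by exact_mod_cast hj1
    have hgap : h j - h' j ≤ h j ^ 3 / 2 * (1 / h' j ^ 2 - 1 / h j ^ 2) := by
      have hwc := abs_sub_le_half_cube_mul (hh j).1 (hh' j).1 le_rfl (hle j)
      rwa [abs_of_nonneg (hg0 j), abs_sub_comm, abs_of_nonneg (hlev0 j)] at hwc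
    have hdrops : (j : ℝ) * ∑ k' ∈ A, G k' j * ρ k' ≤ ∑ l ∈ range j, ∑ k ∈ range K, L k * (h (l + 1 + k) - h' (l + 1 + k)) := by
      have hl : ∀ l ∈ range j, ∑ k' ∈ A, G k' j * ρ k' ≤ ∑ k ∈ range K, L k * (h (l + 1 + k) - h' (l + 1 + k)) := by
        intro l hl
        have hlj : l + 1 ≤ j := mem_range.mp hl
        refine (sum_le_sum fun k' _ => ?_).trans (hddlow l)
        refine mul_le_mul_of_nonneg_right ?_ (hρ0 k')
        have ha' : (0 : ℝ) ≤ k' := Nat.cast_nonneg _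
        have hlj' : ((l : ℝ) + 1) ≤ j := by exact_mod_cast hlj
        simp only [hG_def]
        push_cast
        apply pow_le_pow_left₀ (by positivity)
        exact div_le_div_of_nonneg_left ha' (by positivity) (by linarith)
      have := sum_le_sum hl
      rwa [sum_const, card_range, nsmul_eq_mul] at this
    -- slack ≥ δ_j / j ≥ 0
    have hslack : 0 ≤ η - ∑ k' ∈ A, G k' j * ρ k' := by
      have h1 : (j : ℝ) * (η - ∑ k' ∈ A, G k' j * ρ k') ≥ 1 / h' j ^ 2 - 1 / h j ^ 2 := by linarith [hlev j, hdrops]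
      have h2 := hlev0 j
      nlinarith
    have hxw : 0 ≤ L j * (h j ^ 3 / 2) := mul_nonneg (hL j) (by have := (hh j).1; positivity)
    calc ρ j = L j * (h j - h' j) := rfl
      _ ≤ L j * (h j ^ 3 / 2 * (1 / h' j ^ 2 - 1 / h j ^ 2)) := mul_le_mul_of_nonneg_left hgap (hL j)
      _ = L j * (h j ^ 3 / 2) * (1 / h' j ^ 2 - 1 / h j ^ 2) := by ring
      _ ≤ L j * (h j ^ 3 / 2) * ((j : ℝ) * η - (j : ℝ) * ∑ k' ∈ A, G k' j * ρ k') :=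
          mul_le_mul_of_nonneg_left (by linarith [hlev j, hdrops]) hxw
      _ = (L j * j * h j ^ 3 / 2) * (η - ∑ k' ∈ A, G k' j * ρ k') := by ring
      _ ≤ xh j * (η - ∑ k' ∈ A, G k' j * ρ k') := mul_le_mul_of_nonneg_right (by linarith [hxh j hjA]) hslack
  -- (5) weak duality
  have hclose := sum_le_of_certificate (A := A) (xh := xh) (π := π) (G := G) (fun k _ => hρ0 k) hπ hsys
    (fun k' hk' => by simpa only [hG_def] using hdual k' hk') hcost hη0
  -- (6) the drop at the pin is the sum of the pin reads over A
  have hdrop : B h - B h' = ∑ k ∈ A, ρ k := by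
    have e0 : B h - B h' = ∑ k ∈ range K, L k * (h k - h' k) := by
      simp only [hB_def]; rw [add_sub_add_left_eq_sub, ← sum_sub_distrib]; exact sum_congr rfl fun k _ => by ring
    rw [e0]
    refine (sum_subset hAK fun k hk hkA => ?_).symm
    rcases Nat.eq_zero_or_pos k with rfl | hkpos
    · show L 0 * (h 0 - h' 0) = 0
      rw [hf.1, hf'.1]; ring
    · show L k * (h k - h' k) = 0
      rw [hsupp k hk hkA hkpos.ne']; ring
  have : B h - B h' ≤ η := by rw [hdrop]; exact hclose
  show B h ≤ B' h'
  rw [hη_def] at this; linarith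

/-! ## §3 END: comparison at any size under a trajectory-free slack certificate -/

/-- **THE SLACK CRITERION (trajectory-free): AN AFFINE MEMORY OF SEVERAL AGES COMPARES AT ANY SIZE AS SOON AS ITS SLACK SYSTEM HAS A CERTIFICATE.**
`B(u) = b + Σ_{k<K} L_k·u_k` on ]0,γ] (`b > 0`, `L ≥ 0` supported on `{0} ∪ A`, `A ⊆ [1,K[` ANY finite set of ages; sizes and Markov weight ARBITRARY); with
the PROFILE LOADS `x̂_j = L_j∕(2P_j)`, `P_j = Σ_{k<K} L_k√(j∕(j+k))` (each `≤ √2∕2`; `x̂_j ≥ j·L_j·h_j³∕2` along every box solution from every pin, (E58b)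
`weight_le_profile`), suppose weights `π_k ≥ 0` (`k ∈ A`) satisfy **`π_{k′} + Σ_{j∈A} x̂_j·(k′∕(k′+j))²·π_j ≥ 1`** for every `k′ ∈ A` and
**`Σ_{j∈A} x̂_j·π_j ≤ 1`**.  Then for every `B′ ≥ B` with a zeroth moment and an ISOTONE excess, ANY box solutions from one pin satisfy `h′ ≤ h` at EVERY
scale.  ONE age `j`: `x̂ = √2∕2`, `π = 1∕(1 + √2∕8)` certifies ((E57a) recovered); 30-separated towers of any height: (E64b)∕(E64c).  The criterion is to
(E58b)'s profile condition `Σ_j L_j∕P_j ≤ 2` what the self-consistent bound is to the first-order barrier: the loads may sum past `1` provided the older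
reads load the younger windows. [folklore] -/
theorem le_of_isotone_excess_slack_certificate {p : ℝ} (hL : ∀ k, 0 ≤ L k) (hb : 0 < b) (hAK : A ⊆ range K) (hA1 : ∀ k ∈ A, 1 ≤ k)
    (hsupp : ∀ k ∈ range K, k ∉ A → k ≠ 0 → L k = 0) (hπ : ∀ k ∈ A, 0 ≤ π k)
    (hdual : ∀ k' ∈ A, 1 ≤ π k' + ∑ j ∈ A,
      L j / (2 * ∑ k ∈ range K, L k * Real.sqrt ((j : ℝ) / ((j : ℝ) + k))) * ((k' : ℝ) / ((k' : ℝ) + j)) ^ 2 * π j)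
    (hcost : ∑ j ∈ A, L j / (2 * ∑ k ∈ range K, L k * Real.sqrt ((j : ℝ) / ((j : ℝ) + k))) * π j ≤ 1)
    (hB' : ∀ u u' : ℕ → ℝ, SeqBox γ u → SeqBox γ u' → ∀ D : ℝ, (∀ j, |u j - u' j| ≤ D) → |B' u - B' u'| ≤ M' * D) (hM' : 0 ≤ M')
    (hexc : ∀ u, SeqBox γ u → (fun u : ℕ → ℝ => b + ∑ k ∈ range K, L k * u k) u ≤ B' u)
    (hDmono : ∀ u v : ℕ → ℝ, SeqBox γ u → SeqBox γ v → (∀ j, u j ≤ v j) →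
      B' u - (fun u : ℕ → ℝ => b + ∑ k ∈ range K, L k * u k) u ≤ B' v - (fun u : ℕ → ℝ => b + ∑ k ∈ range K, L k * u k) v)
    (hp : 0 < p) (hpγ : p ≤ γ) (hh : SeqBox γ h) (hf : MemFlow (fun u : ℕ → ℝ => b + ∑ k ∈ range K, L k * u k) p h)
    (hh' : SeqBox γ h') (hf' : MemFlow B' p h') (j : ℕ) : h' j ≤ h j := by
  have hmono := affine_monotone (γ := γ) (b₀ := b) (K := K) hL
  have hlo := affine_floor (γ := γ) (b₀ := b) (K := K) hL
  have hdom : ∀ u, SeqBox γ u → ∑ k ∈ range K, L k * u k ≤ (fun u : ℕ → ℝ => b + ∑ k ∈ range K, L k * u k) u := fun u _ => by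
    simp only; linarith
  refine le_of_isotone_excess_of_step_below (B := fun u : ℕ → ℝ => b + ∑ k ∈ range K, L k * u k) hmono
    (affine_zerothMoment hL) (sum_nonneg fun k _ => hL k) hb hlo hB' hM' hexc hDmono
    (fun _ _ hS huniq hS' huniq' _ hy _ hdeep u _ hu hfu hu' hfu' hle =>
      effective_le_of_family_le_at_certificate
        (xh := fun j => L j / (2 * ∑ k ∈ range K, L k * Real.sqrt ((j : ℝ) / ((j : ℝ) + k))))
        hL hb hAK hA1 hsupp hexc hDmono hS huniq hS' huniq' hy hdeep hu hfu hu' hfu' hle (fun j hjA => ?_) hπ hdual hcost)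
    hp hpγ hh hf hh' hf' j
  -- the profile load bound along the trajectory: L_j·j·h_j³ ≤ L_j∕P_j = 2·x̂_j
  have := weight_le_profile hmono hL hb hlo hdom hy hu hfu (hAK hjA)
  have e : 2 * (L j / (2 * ∑ k ∈ range K, L k * Real.sqrt ((j : ℝ) / ((j : ℝ) + k)))) =
      L j / ∑ k ∈ range K, L k * Real.sqrt ((j : ℝ) / ((j : ℝ) + k)) := by
    rw [← mul_div_assoc, mul_div_mul_left _ _ (two_ne_zero' ℝ)]
  rw [e]; exact this

end Summit.QuantumFields.BalabanUV.Beta.EriceRemainderEnclosureHistoryAutonomyComparisonSlackCriterion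

end
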